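import Mathlib
import Literature.Computability.Complexity.CNF
import Summits.PneNP.PneNP.Theorems.OverlapGapAlgebraNoStableSection
import Summits.PneNP.PneNP.Theorems.OverlapGapAlgebraSolvableImpliesStableSectionMeanSquareTransferRate

/-!
# PneNP / OverlapGapAlgebra — `SearchHardWindow` (stmt-PneNP-2460): the mean-square rung WITH A RATE

Support for crux `stmt-PneNP-2460` (`Summit.PneNP.PneNP.Theses.OverlapGapAlgebra.SearchHardWindow`).
Quantitative form of the mean-square rung (`shwMS_meanSquareStableMapsFail`, success `≤ ε` for every
constant `ε`): in the Bresler–Huang window `α_k = 5·2^k log k/k`, `k ≥ k₀`, an ℓ²-stable search map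
succeeds with probability at most POLYNOMIALLY SMALL,
`Pr[g solves F_k(n, ⌊α_k n⌋)] ≤ C_k · (1 + s₂(n) log² n) / n` eventually,
where `s₂(n)` bounds its mean-square single-literal-resample sensitivity (`s₂ log³ n = o(n)`). For
`O(1)`-Lipschitz maps (radius-1 label-dependent local rules, majority-type votes, …; `s₂ = O(1)`) this is
`O(log² n / n)`. Mechanism: the transfer from polynomially small success
(`sissMSR_concl_of_rateSolver`) against the proved probability crux `NoStableSection`
(`noStableSection_proof`); the constant is `C_k = 144 k/(ν_k² α_k)` with `ν_k` the validity parameter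
of `NoStableSection` at `k`.

* `shwMSR_successCount_le_rate_of_noStableSection`, `shwMSR_successCount_le_rate` — counting form
  (modulo / with `NoStableSection`);
* `shwMSR_successRatio_le_rate` — the success RATIO of any `f : List Bool → List Bool` whose decoded
  section is eventually ℓ²-stable at scale `s₂`, in the crux's vocabulary.
No new definitions; axioms `propext`, `Classical.choice`, `Quot.sound`.
-/

set_option linter.dupNamespace false -- `Summit.PneNP.PneNP.…`: summit = sub-problem (D-0017)

namespace Summit.PneNP.PneNP.Theorems

open Finset Filter Asymptotics
open scoped Classical

/-- **Polynomially small success for ℓ²-stable maps in the window, modulo `NoStableSection`.** Assuming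
`NoStableSection` (stmt-PneNP-2462, proved): for all `k ≥ k₀` there is `C > 0` such that for every
`s₂ : ℕ → ℝ` with `s₂(n) log³ n = o(n)`, eventually in `n`, every map `g` on `F_k(n, ⌊α_k n⌋)` with
`0 ≤ s₂(n)` and `∑_{(a,b)} ∑_{(Φ,ℓ)} d_H(g Φ, g Φ[(a,b) ↦ ℓ])² ≤ s₂(n)·(m k)·#Inst·2n` solves at most
`C · (1 + s₂(n) log² n)/n · #Inst` instances. -/
theorem shwMSR_successCount_le_rate_of_noStableSection
    (hNo : Summit.PneNP.PneNP.Theses.OverlapGapAlgebra.NoStableSection) :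
    ∃ k₀ : ℕ, ∀ k : ℕ, k₀ ≤ k → ∃ C : ℝ, 0 < C ∧ ∀ s₂ : ℕ → ℝ,
      (fun n : ℕ => s₂ n * Real.log n ^ 3) =o[atTop] (fun n : ℕ => (n : ℝ)) →
      ∀ᶠ n : ℕ in atTop, ∀ m : ℕ, m = ⌊5 * 2 ^ k * Real.log k / k * n⌋₊ →
        ∀ g : (Fin m → Fin k → Fin n × Bool) → (Fin n → Bool), 0 ≤ s₂ n →
          (∑ a : Fin m, ∑ b : Fin k, ∑ p : (Fin m → Fin k → Fin n × Bool) × (Fin n × Bool),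
            (hammingDist (g p.1) (g (Function.update p.1 a (Function.update (p.1 a) b p.2))) : ℝ) ^ 2)
            ≤ s₂ n * (((m * k : ℕ) : ℝ) * (Fintype.card (Fin m → Fin k → Fin n × Bool) * (2 * n))) →
          ((Finset.univ.filter fun Φ : Fin m → Fin k → Fin n × Bool =>
              ∀ i, ∃ j, g Φ (Φ i j).1 = (Φ i j).2).card : ℝ)
            ≤ C * (1 + Real.log n ^ 2 * s₂ n) / n * Fintype.card (Fin m → Fin k → Fin n × Bool) := by
  obtain ⟨k₀, hk₀⟩ := hNo
  refine ⟨max k₀ 2, fun k hk => ?_⟩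
  have hk₀k : k₀ ≤ k := le_trans (le_max_left _ _) hk
  have hk2 : 2 ≤ k := le_trans (le_max_right _ _) hk
  have hk1 : 1 ≤ k := le_trans (by norm_num) hk2
  have hk0 : (0 : ℝ) < k := by exact_mod_cast (lt_of_lt_of_le Nat.zero_lt_one hk1)
  obtain ⟨η, hη, ν, hν, c, hc, hNSS⟩ := hk₀ k hk₀k
  set α : ℝ := 5 * 2 ^ k * Real.log k / k with hαdef
  have hαpos : 0 < α := by
    have hk2R : (2 : ℝ) ≤ k := by exact_mod_cast hk2
    have hlogk : 0 < Real.log k := Real.log_pos (by linarith only [hk2R])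
    rw [hαdef]; positivity
  have hν2 : 0 < ν ^ 2 := by positivity
  refine ⟨144 * k / (ν ^ 2 * α), by positivity, fun s₂ hs => ?_⟩
  -- suppose not: frequently some ℓ²-stable map beats the rate
  by_contra hcon
  rw [Filter.not_eventually] at hcon
  have hlarge : ∀ᶠ n : ℕ in atTop, 2 / α ≤ (n : ℝ) :=
    tendsto_natCast_atTop_atTop.eventually_ge_atTop _
  have hsolv : ∃ᶠ n : ℕ in atTop, ∀ m : ℕ, m = ⌊α * n⌋₊ →
      ∃ g : (Fin m → Fin k → Fin n × Bool) → (Fin n → Bool), 0 ≤ s₂ n ∧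
        (∑ a : Fin m, ∑ b : Fin k, ∑ p : (Fin m → Fin k → Fin n × Bool) × (Fin n × Bool),
          (hammingDist (g p.1) (g (Function.update p.1 a (Function.update (p.1 a) b p.2))) : ℝ) ^ 2)
          ≤ s₂ n * (((m * k : ℕ) : ℝ) * (Fintype.card (Fin m → Fin k → Fin n × Bool) * (2 * n))) ∧
        8 * k * (2 + 9 * Real.log n ^ 2 * s₂ n) / (ν ^ 2 * m)
            * Fintype.card (Fin m → Fin k → Fin n × Bool) ≤
          ((Finset.univ.filter fun Φ : Fin m → Fin k → Fin n × Bool =>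
            ∀ i, ∃ j, g Φ (Φ i j).1 = (Φ i j).2).card : ℝ) := by
    refine (hcon.and_eventually hlarge).mono ?_
    rintro n ⟨hn, hnα⟩
    push Not at hn
    obtain ⟨m, hm, g, hs0, hgMS, hlt⟩ := hn
    intro m' hm'
    have hmm : m = m' := hm.trans hm'.symm
    subst hmm
    refine ⟨g, hs0, hgMS, le_trans ?_ hlt.le⟩
    -- the threshold is below the rate: `8k(2 + 9 log² n s₂)/(ν² m) ≤ (144k/(ν²α))·(1 + log² n s₂)/n`
    have hnpos : (0 : ℝ) < n := by
      have : 0 < 2 / α := by positivity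
      exact this.trans_le hnα
    have hαn2 : 2 ≤ α * n := by
      have h := (div_le_iff₀ hαpos).1 hnα
      linarith only [h]
    have hm_ge : α * n - 1 ≤ m := by
      rw [hm]; have := Nat.lt_floor_add_one (α * n); linarith only [this]
    have hm2 : α * n / 2 ≤ m := by linarith only [hm_ge, hαn2]
    have hmpos : (0 : ℝ) < m := by
      have : 0 < α * n / 2 := by positivity
      exact this.trans_le hm2
    have hx : 0 ≤ Real.log n ^ 2 * s₂ n := by positivity
    apply mul_le_mul_of_nonneg_right _ (Nat.cast_nonneg _)
    have h1 : 8 * k * (2 + 9 * Real.log n ^ 2 * s₂ n) / (ν ^ 2 * m)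
        ≤ 8 * k * (2 + 9 * Real.log n ^ 2 * s₂ n) / (ν ^ 2 * (α * n / 2)) := by
      apply div_le_div_of_nonneg_left (by positivity) (by positivity)
      exact mul_le_mul_of_nonneg_left hm2 hν2.le
    have hν0 : ν ≠ 0 := hν.ne'
    have hα0 : α ≠ 0 := hαpos.ne'
    have hn0 : (n : ℝ) ≠ 0 := hnpos.ne'
    have h2 : 8 * k * (2 + 9 * Real.log n ^ 2 * s₂ n) / (ν ^ 2 * (α * n / 2))
        = 16 * k * (2 + 9 * Real.log n ^ 2 * s₂ n) / (ν ^ 2 * α * n) := by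
      field_simp
      ring
    have h3 : 16 * (k : ℝ) * (2 + 9 * Real.log n ^ 2 * s₂ n) ≤ 144 * k * (1 + Real.log n ^ 2 * s₂ n) := by
      nlinarith only [hk0, hx]
    have h4 : 16 * k * (2 + 9 * Real.log n ^ 2 * s₂ n) / (ν ^ 2 * α * n)
        ≤ 144 * k * (1 + Real.log n ^ 2 * s₂ n) / (ν ^ 2 * α * n) :=
      div_le_div_of_nonneg_right h3 (by positivity)
    have h5 : 144 * k * (1 + Real.log n ^ 2 * s₂ n) / (ν ^ 2 * α * n)
        = 144 * k / (ν ^ 2 * α) * (1 + Real.log n ^ 2 * s₂ n) / n := by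
      field_simp
    calc 8 * k * (2 + 9 * Real.log n ^ 2 * s₂ n) / (ν ^ 2 * m)
        ≤ 8 * k * (2 + 9 * Real.log n ^ 2 * s₂ n) / (ν ^ 2 * (α * n / 2)) := h1
      _ = 16 * k * (2 + 9 * Real.log n ^ 2 * s₂ n) / (ν ^ 2 * α * n) := h2
      _ ≤ 144 * k * (1 + Real.log n ^ 2 * s₂ n) / (ν ^ 2 * α * n) := h4
      _ = 144 * k / (ν ^ 2 * α) * (1 + Real.log n ^ 2 * s₂ n) / n := h5
  have hc2 : 0 < c / 2 := by positivity
  have hconcl := sissMSR_concl_of_rateSolver k hk1 α η ν hαpos hη hν s₂ hs hsolv (c / 2) hc2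
  -- contradiction with `NoStableSection`'s eventual upper bound
  obtain ⟨n, hn, hNn, hn1⟩ := (hconcl.and_eventually (hNSS.and (eventually_ge_atTop 1))).exists
  obtain ⟨g, hg⟩ := hn _ rfl
  have hup := hNn _ rfl g
  have key : Real.exp (-(c / 2 * n)) *
      (Fintype.card (Fin (k + 1) → Fin ⌊α * n⌋₊ → Fin k → Fin n × Bool) : ℝ)
      ≤ Real.exp (-(c * n)) *
        (Fintype.card (Fin (k + 1) → Fin ⌊α * n⌋₊ → Fin k → Fin n × Bool) : ℝ) :=
    hg.trans (((Nat.cast_le (α := ℝ)).2 (Finset.card_le_card fun Ψ h => by simpa using h)).trans hup)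
  haveI : Nonempty (Fin n × Bool) := ⟨(⟨0, hn1⟩, true)⟩
  have hP : (0 : ℝ) < (Fintype.card (Fin (k + 1) → Fin ⌊α * n⌋₊ → Fin k → Fin n × Bool) : ℝ) := by
    exact_mod_cast Fintype.card_pos
  have hexp := le_of_mul_le_mul_right key hP
  rw [Real.exp_le_exp] at hexp
  have hnR : (1 : ℝ) ≤ n := by exact_mod_cast hn1
  have hcn : 0 < c * n := by positivity
  linarith only [hexp, hcn]

/-- **Polynomially small success for ℓ²-stable maps in the window (unconditional).** For all `k ≥ k₀`
there is `C > 0` such that for every `s₂ : ℕ → ℝ` with `s₂(n) log³ n = o(n)`, eventually in `n`, every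
search map `g` on `F_k(n, ⌊α_k n⌋)`, `α_k = 5·2^k log k/k`, of mean-square single-literal-resample
sensitivity at most `s₂(n) ≥ 0` solves at most a `C(1 + s₂(n) log² n)/n` fraction of the instances —
`O(log² n / n)` for `O(1)`-Lipschitz maps. -/
theorem shwMSR_successCount_le_rate :
    ∃ k₀ : ℕ, ∀ k : ℕ, k₀ ≤ k → ∃ C : ℝ, 0 < C ∧ ∀ s₂ : ℕ → ℝ,
      (fun n : ℕ => s₂ n * Real.log n ^ 3) =o[atTop] (fun n : ℕ => (n : ℝ)) →
      ∀ᶠ n : ℕ in atTop, ∀ m : ℕ, m = ⌊5 * 2 ^ k * Real.log k / k * n⌋₊ →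
        ∀ g : (Fin m → Fin k → Fin n × Bool) → (Fin n → Bool), 0 ≤ s₂ n →
          (∑ a : Fin m, ∑ b : Fin k, ∑ p : (Fin m → Fin k → Fin n × Bool) × (Fin n × Bool),
            (hammingDist (g p.1) (g (Function.update p.1 a (Function.update (p.1 a) b p.2))) : ℝ) ^ 2)
            ≤ s₂ n * (((m * k : ℕ) : ℝ) * (Fintype.card (Fin m → Fin k → Fin n × Bool) * (2 * n))) →
          ((Finset.univ.filter fun Φ : Fin m → Fin k → Fin n × Bool =>
              ∀ i, ∃ j, g Φ (Φ i j).1 = (Φ i j).2).card : ℝ)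
            ≤ C * (1 + Real.log n ^ 2 * s₂ n) / n * Fintype.card (Fin m → Fin k → Fin n × Bool) :=
  shwMSR_successCount_le_rate_of_noStableSection noStableSection_proof

/-- **Success ratio of ℓ²-stable solvers in the window: a polynomial rate (unconditional).** For all
`k ≥ k₀` there is `C > 0` such that for ANY `f : List Bool → List Bool` (no complexity hypothesis) whose
decoded section `Φ ↦ (v ↦ (f ⌜Φ⌝).getD v false)` on `F_k(n, ⌊α_k n⌋)` has, eventually in `n`,
mean-square single-literal-resample sensitivity at most `s₂(n) ≥ 0`, `s₂(n) log³ n = o(n)`: the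
success ratio of `f` is eventually `≤ C · (1 + s₂(n) log² n)/n` — a quantitative form of the
hardness conjunct of `SearchHardWindow` for this class. -/
theorem shwMSR_successRatio_le_rate :
    ∃ k₀ : ℕ, ∀ k : ℕ, k₀ ≤ k → ∃ C : ℝ, 0 < C ∧ ∀ (f : List Bool → List Bool) (s₂ : ℕ → ℝ),
      (fun n : ℕ => s₂ n * Real.log n ^ 3) =o[atTop] (fun n : ℕ => (n : ℝ)) →
      (∀ᶠ n : ℕ in atTop, ∀ m : ℕ, m = ⌊5 * 2 ^ k * Real.log k / k * n⌋₊ →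
        ∃ g : (Fin m → Fin k → Fin n × Bool) → (Fin n → Bool),
          (∀ (Φ : Fin m → Fin k → Fin n × Bool) (v : Fin n), g Φ v =
            (f (Literature.Computability.Complexity.encodingCNF.encode (List.ofFn fun a =>
              List.ofFn fun b => (((Φ a b).1 : ℕ), (Φ a b).2)))).getD v false) ∧ 0 ≤ s₂ n ∧
          (∑ a : Fin m, ∑ b : Fin k, ∑ p : (Fin m → Fin k → Fin n × Bool) × (Fin n × Bool),
            (hammingDist (g p.1) (g (Function.update p.1 a (Function.update (p.1 a) b p.2))) : ℝ) ^ 2)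
            ≤ s₂ n * (((m * k : ℕ) : ℝ) * (Fintype.card (Fin m → Fin k → Fin n × Bool) * (2 * n)))) →
      ∀ᶠ n : ℕ in Filter.atTop, ∀ m : ℕ, m = ⌊5 * 2 ^ k * Real.log k / k * n⌋₊ →
        ((Finset.univ.filter fun Φ : Fin m → Fin k → Fin n × Bool => ∀ i, ∃ j,
            (f (Literature.Computability.Complexity.encodingCNF.encode (List.ofFn fun a =>
              List.ofFn fun b => (((Φ a b).1 : ℕ), (Φ a b).2)))).getD (Φ i j).1 false =
                (Φ i j).2).card : ℝ) / Fintype.card (Fin m → Fin k → Fin n × Bool)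
          ≤ C * (1 + Real.log n ^ 2 * s₂ n) / n := by
  obtain ⟨k₀, h⟩ := shwMSR_successCount_le_rate
  refine ⟨k₀, fun k hk => ?_⟩
  obtain ⟨C, hC, hmain⟩ := h k hk
  refine ⟨C, hC, fun f s₂ hs hf => ?_⟩
  filter_upwards [hmain s₂ hs, hf] with n hmn hfn m hm
  obtain ⟨g, hgf, hs0, hg⟩ := hfn m hm
  have hle := hmn m hm g hs0 hg
  have hset : ((Finset.univ.filter fun Φ : Fin m → Fin k → Fin n × Bool => ∀ i, ∃ j,
      (f (Literature.Computability.Complexity.encodingCNF.encode (List.ofFn fun a =>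
        List.ofFn fun b => (((Φ a b).1 : ℕ), (Φ a b).2)))).getD (Φ i j).1 false = (Φ i j).2))
      = (Finset.univ.filter fun Φ : Fin m → Fin k → Fin n × Bool =>
          ∀ i, ∃ j, g Φ (Φ i j).1 = (Φ i j).2) := by
    refine Finset.filter_congr fun Φ _ => ?_
    simp only [hgf]
  rw [hset]
  by_cases hN : (Fintype.card (Fin m → Fin k → Fin n × Bool) : ℝ) = 0
  · rw [hN, div_zero]
    have hx : 0 ≤ Real.log n ^ 2 * s₂ n := by positivity
    positivity
  · have hNpos : (0 : ℝ) < Fintype.card (Fin m → Fin k → Fin n × Bool) :=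
      lt_of_le_of_ne (Nat.cast_nonneg _) (Ne.symm hN)
    rw [div_le_iff₀ hNpos]
    exact hle

end Summit.PneNP.PneNP.Theorems
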